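import Summits.BirchSwinnertonDyer.BirchSwinnertonDyer.Theorems.PrintCFramBottomClassIndexLawFiveLeFlipRungTwoThetaSeries
import HarnessLib

set_option autoImplicit false

/-!
# Crux `PrintCFram.BottomClassIndexLawFiveLe` (stmt-BirchSwinnertonDyer-20372), line `eisenstein-resource-bdp-line` (registry v29):
# T6 «THE 2-ADIC FLIPPED-CUSP RUNG», piece P4d — THE BRACKET `B` AND THE NF-Q TRANSPORT AT THE FLIPPED CUSP
# (cell `bsd-print-cfram`, width seat `bsd-line-cfram-p1-w5` g8; THEOREMS ONLY, `--supports` 20372; BSD is not proved by any of this)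

HONEST FRAMING. Analysis of the bracket `B(z) := 8^{−(k+1)}·P(γ₀•z)·(√((Mz+64)/8)^{2k+1})⁻¹` of P4b's factorisation
`V ∣ γ₀ = Θ·B` (`V = P·θ`, `P = classProj c g ∈ M_{(2k+1)/2}(N_P, ψ)` from P2, `γ₀ = [a b; M 64]`), and the APPLICATION of w3 g19's
transport `exists_isIntegral_qExpansion_coeff_of_slash_eq_mul`; nothing here is a statement about elliptic curves, Bernoulli numbers or
BSD; no registered stub is closed; NF-Q (Katz 1973 Cor. 1.6.2) enters as a HYPOTHESIS exactly as in T4/T8.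
* §1 THE CONJUGATION `γ₀·T²⁵⁶ = N·γ₀`, `N = [1 − 256aM, 256a²; −256M², 1 + 256aM] = [1 − 4M′u, u²; −16M′², 1 + 4M′u]` with `M′ = 4M`,
  `u = 16a` — so P3's multiplier lemmas apply VERBATIM (`thetaEps_one_add_four_mul`, `shimuraSymbol_neg_sq_one_add_four_mul`): for
  `P ∈ halfIntModularForms κ N_P ψ`, `4 ∣ N_P`, `N_P ∣ 256M` (P2's level `128M′` qualifies): `P(γ₀•(z+256))·(√Y^κ)⁻¹ = P(γ₀•z)·(√X^κ)⁻¹`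
  for every admissible base pair, hence **`bracket_periodic`**: `B(z + 256) = B(z)` with P1's base.
* §2 `B` is holomorphic and bounded at `i∞` (`‖B‖² = 8⁻¹·‖slashSq (2k+1) P γ₀‖`, the cusp condition of `P`) ⟹ `AnalyticAt (cuspFunction N B) 0`
  and Mathlib's `hasSum_qExpansion` for `256 ∣ N`.
* §3 **`exists_isIntegral_bracket_coeff`** — THE TRANSPORT: NF-Q + `f : ModularForm (Gamma1 L) (k+1)` with `⇑f = P·θ` and every coefficient
  of `qExpansion 1 f` in `p·ℤ̄[1/N]` ⟹ EVERY coefficient of `qExpansion N B` lies in `p·ℤ̄[1/N]` (P4b `slash_flippedCusp_eq_theta_mul_bracket`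
  + P4c `theta_transport_hypotheses` + §2). What T6e still has to do: identify `qExpansion N B` with `8^{−(k+1)}(ODD + JUNK)` via P1c's
  `HasSum` and P3's `coeff_eq_of_periodic_junk`, and read the unit weights (T6a).
beyond-print theorem: NO.

References: [Shimura1973HalfIntegral] §1; [Katz1973] §1.6 Cor. 1.6.2 (NF-Q, hypothesis); [DiamondShurman2005] §1.1–1.2; crux notes w7g8-T6 v4 §5d.
-/

-- summit-side namespace `Summit.BirchSwinnertonDyer.BirchSwinnertonDyer.…` (single-conjunct summit, D-0017 layout)
set_option linter.dupNamespace false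

noncomputable section

open scoped MatrixGroups ModularForm Real Classical Topology Manifold NumberTheorySymbols
open UpperHalfPlane hiding I
open Complex CongruenceSubgroup Function Filter
open Literature.NumberTheory.EllipticCurves.ModularForms

namespace Summit.BirchSwinnertonDyer.BirchSwinnertonDyer.Theorems.PrintCFram.FlipRung

/-! ## §1 The conjugation `γ₀ T²⁵⁶ = N γ₀` and the periodicity of the normalised `P(γ₀•z)` -/

/-- **`γ₀·T²⁵⁶ = N·γ₀`** in `SL₂(ℤ)` for `γ₀ = [a b; M 64]` and `N = [1 − 256aM, 256a²; −256M², 1 + 256aM]` (uses `64a − bM = 1`). [folklore] -/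
theorem cusp_mul_T_pow_eq (γ₀ N : SL(2, ℤ)) {M : ℤ} (hM : γ₀ 1 0 = M) (h64 : γ₀ 1 1 = 64)
    (n00 : N 0 0 = 1 - 256 * γ₀ 0 0 * M) (n01 : N 0 1 = 256 * γ₀ 0 0 ^ 2) (n10 : N 1 0 = -(256 * M ^ 2))
    (n11 : N 1 1 = 1 + 256 * γ₀ 0 0 * M) :
    γ₀ * ModularGroup.T ^ (256 : ℤ) = N * γ₀ := by
  have hdet : γ₀ 0 0 * 64 - γ₀ 0 1 * M = 1 := by
    have := Matrix.det_fin_two (γ₀ : Matrix (Fin 2) (Fin 2) ℤ)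
    rw [Matrix.SpecialLinearGroup.det_coe, hM, h64] at this
    linear_combination -this
  ext i j
  rw [Matrix.SpecialLinearGroup.coe_mul, Matrix.SpecialLinearGroup.coe_mul, ModularGroup.coe_T_zpow]
  fin_cases i <;> fin_cases j
  · simp [Matrix.mul_apply, Fin.sum_univ_two, hM, n00, n01]; ring
  · simp [Matrix.mul_apply, Fin.sum_univ_two, h64, n00, n01]
    linear_combination (-256 * γ₀ 0 0) * hdet
  · simp [Matrix.mul_apply, Fin.sum_univ_two, hM, h64, n10, n11]; ring
  · simp [Matrix.mul_apply, Fin.sum_univ_two, hM, h64, n10, n11]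
    linear_combination (-256 * M) * hdet

/-- **The point identity and the denominator:** `N • (γ₀ • w) = γ₀ • (w + 256)` and `denom N (γ₀•w) = (M(w+256)+64)/(Mw+64)`.
[cite: DiamondShurman2005, §1.2] -/
theorem cuspConj_smul_eq (γ₀ N : SL(2, ℤ)) {M : ℤ} (hM : γ₀ 1 0 = M) (h64 : γ₀ 1 1 = 64)
    (n00 : N 0 0 = 1 - 256 * γ₀ 0 0 * M) (n01 : N 0 1 = 256 * γ₀ 0 0 ^ 2) (n10 : N 1 0 = -(256 * M ^ 2))
    (n11 : N 1 1 = 1 + 256 * γ₀ 0 0 * M) (w : ℍ) :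
    N • (γ₀ • w) = γ₀ • ((256 : ℝ) +ᵥ w) ∧
    denom N ((γ₀ • w : ℍ)) = ((M : ℂ) * ((((256 : ℝ) +ᵥ w : ℍ)) : ℂ) + 64) / ((M : ℂ) * w + 64) := by
  have hdet : γ₀ 0 0 * 64 - γ₀ 0 1 * M = 1 := by
    have := Matrix.det_fin_two (γ₀ : Matrix (Fin 2) (Fin 2) ℤ)
    rw [Matrix.SpecialLinearGroup.det_coe, hM, h64] at this
    linear_combination -this
  have hmat := cusp_mul_T_pow_eq γ₀ N hM h64 n00 n01 n10 n11
  have hsmul : N • (γ₀ • w) = γ₀ • ((256 : ℝ) +ᵥ w) := by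
    rw [← mul_smul, ← hmat, mul_smul, UpperHalfPlane.modular_T_zpow_smul]
    norm_num
  refine ⟨hsmul, ?_⟩
  -- the denominator, as a complex-number computation
  have hden0 : denom γ₀ w = (M : ℂ) * w + 64 := by rw [ModularGroup.denom_apply, hM, h64]; push_cast; ring
  have hw : (M : ℂ) * w + 64 ≠ 0 := by rw [← hden0]; exact denom_ne_zero γ₀ w
  have hdetC : (γ₀ 0 0 : ℂ) * 64 - (γ₀ 0 1 : ℂ) * M = 1 := by exact_mod_cast hdet
  have hγw : ((γ₀ • w : ℍ) : ℂ) = ((γ₀ 0 0 : ℂ) * w + (γ₀ 0 1 : ℂ)) / ((M : ℂ) * w + 64) := by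
    rw [coe_specialLinearGroup_apply, hM, h64]
    simp only [eq_intCast, Int.cast_ofNat]
    push_cast
    ring
  rw [ModularGroup.denom_apply, n10, n11, hγw, coe_vadd]
  push_cast
  rw [eq_div_iff hw]
  field_simp
  linear_combination (256 * (M : ℂ)) * hdetC

/-- **The automorphy factor of `N` at `γ₀•w` is the ratio of P1's bases:** for `4 ∣ N_P`... in fact for any `ψ` with `N_P ∣ 256M`:
`autFactor κ N_P ψ N (γ₀•w) = √((M(w+256)+64)/(Mw+64))^κ` — `ε_d = 1` and `(−256M²/d) = 1` by P3's lemmas at `(M′, u) = (4M, 16a)`.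
[cite: Shimura1973HalfIntegral, §1] -/
theorem autFactor_cuspConj_eq {κ NP : ℕ} (ψ : DirichletCharacter ℂ NP) (γ₀ N : SL(2, ℤ)) {M : ℤ} (hM : γ₀ 1 0 = M)
    (h64 : γ₀ 1 1 = 64) (hM0 : M ≠ 0)
    (n00 : N 0 0 = 1 - 256 * γ₀ 0 0 * M) (n01 : N 0 1 = 256 * γ₀ 0 0 ^ 2) (n10 : N 1 0 = -(256 * M ^ 2))
    (n11 : N 1 1 = 1 + 256 * γ₀ 0 0 * M) (hNP : (NP : ℤ) ∣ 256 * M) (w : ℍ) :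
    autFactor κ NP ψ N (γ₀ • w) =
      Complex.sqrt (((M : ℂ) * ((w : ℂ) + 256) + 64) / ((M : ℂ) * w + 64)) ^ κ := by
  obtain ⟨-, hden⟩ := cuspConj_smul_eq γ₀ N hM h64 n00 n01 n10 n11 w
  have hψ : ψ ((N 1 1 : ℤ) : ZMod NP) = 1 := by
    rw [n11]
    have hd : (NP : ℤ) ∣ 256 * γ₀ 0 0 * M := by
      obtain ⟨c, hc⟩ := hNP; exact ⟨c * γ₀ 0 0, by linear_combination γ₀ 0 0 * hc⟩
    have h1 : (((1 + 256 * γ₀ 0 0 * M : ℤ)) : ZMod NP) = 1 := by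
      rw [Int.cast_add, Int.cast_one, (ZMod.intCast_zmod_eq_zero_iff_dvd _ NP).mpr hd, add_zero]
    rw [h1, map_one]
  have hθ : thetaFactor (N 1 0) (N 1 1) (γ₀ • w) = Complex.sqrt (((M : ℂ) * ((w : ℂ) + 256) + 64) / ((M : ℂ) * w + 64)) := by
    unfold thetaFactor
    have hcd : ((N 1 0 : ℤ) : ℂ) * ((γ₀ • w : ℍ) : ℂ) + ((N 1 1 : ℤ) : ℂ) =
        ((M : ℂ) * ((w : ℂ) + 256) + 64) / ((M : ℂ) * w + 64) := by
      rw [← ModularGroup.denom_apply, hden, coe_vadd]; push_cast; ring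
    have hε : thetaEps (N 1 1) = 1 := by
      rw [n11, show (1 + 256 * γ₀ 0 0 * M : ℤ) = 1 + 4 * (4 * M) * (16 * γ₀ 0 0) by ring]
      exact thetaEps_one_add_four_mul _ _
    have hσ : shimuraSymbol (N 1 0) (N 1 1) = 1 := by
      rw [n10, n11, show (-(256 * M ^ 2) : ℤ) = -(16 * (4 * M) ^ 2) by ring,
        show (1 + 256 * γ₀ 0 0 * M : ℤ) = 1 + 4 * (4 * M) * (16 * γ₀ 0 0) by ring]
      exact shimuraSymbol_neg_sq_one_add_four_mul (by omega) _
    rw [hcd, hε, hσ]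
    simp
  rw [autFactor, hψ, hθ, one_mul]

/-- **THE NORMALISED `P(γ₀•z)` IS `256`-PERIODIC** for `P ∈ halfIntModularForms κ N_P ψ` with `4 ∣ N_P`, `N_P ∣ 256M` (`M > 0`), and any
admissible base pair `X, Y` in the upper half-plane with `Y/X = (M(w+256)+64)/(Mw+64)`:
`P(γ₀•(w+256))·(√Y^κ)⁻¹ = P(γ₀•w)·(√X^κ)⁻¹`. [cite: Shimura1973HalfIntegral, §1] -/
theorem cuspTranslate_periodic_of_ratio {κ NP : ℕ} {ψ : DirichletCharacter ℂ NP} (h4 : 4 ∣ NP) {P : ℍ → ℂ}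
    (hP : P ∈ halfIntModularForms κ NP ψ) (γ₀ : SL(2, ℤ)) {M : ℤ} (hM : γ₀ 1 0 = M) (h64 : γ₀ 1 1 = 64)
    (hM0 : M ≠ 0) (hNP : (NP : ℤ) ∣ 256 * M) (w : ℍ)
    {X Y : ℂ} (hX : 0 < X.im) (hY : 0 < Y.im) (hXY : Y / X = ((M : ℂ) * ((w : ℂ) + 256) + 64) / ((M : ℂ) * w + 64)) :
    P (γ₀ • ((256 : ℝ) +ᵥ w)) * (Complex.sqrt Y ^ κ)⁻¹ = P (γ₀ • w) * (Complex.sqrt X ^ κ)⁻¹ := by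
  let N : SL(2, ℤ) := ⟨!![1 - 256 * γ₀ 0 0 * M, 256 * γ₀ 0 0 ^ 2; -(256 * M ^ 2), 1 + 256 * γ₀ 0 0 * M], by
    rw [Matrix.det_fin_two_of]; ring⟩
  have n00 : N 0 0 = 1 - 256 * γ₀ 0 0 * M := rfl
  have n01 : N 0 1 = 256 * γ₀ 0 0 ^ 2 := rfl
  have n10 : N 1 0 = -(256 * M ^ 2) := rfl
  have n11 : N 1 1 = 1 + 256 * γ₀ 0 0 * M := rfl
  obtain ⟨hsmul, -⟩ := cuspConj_smul_eq γ₀ N hM h64 n00 n01 n10 n11 w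
  have hmem : N ∈ Gamma0 NP := by
    rw [Gamma0_mem, n10, ZMod.intCast_zmod_eq_zero_iff_dvd]
    obtain ⟨c, hc⟩ := hNP
    exact ⟨-(c * M), by linear_combination (-M) * hc⟩
  have haut := apply_smul_eq_of_mem (k := κ) (χ := ψ) h4 hP hmem (γ₀ • w)
  rw [hsmul, autFactor_cuspConj_eq ψ γ₀ N hM h64 hM0 n00 n01 n10 n11 hNP w, ← hXY, csqrt_div_eq_of_im_pos hX hY, div_pow] at haut
  have hsX : Complex.sqrt X ^ κ ≠ 0 := by
    refine pow_ne_zero κ fun h0 ↦ ?_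
    have : X = 0 := by rw [← csqrt_sq X, h0]; ring
    rw [this] at hX; simp at hX
  have hsY : Complex.sqrt Y ^ κ ≠ 0 := by
    refine pow_ne_zero κ fun h0 ↦ ?_
    have : Y = 0 := by rw [← csqrt_sq Y, h0]; ring
    rw [this] at hY; simp at hY
  rw [haut]
  field_simp

/-- **`bracket_periodic`: P1's BRACKET IS `256`-PERIODIC.** With `B(z) = 8^{−(k+1)}·P(γ₀•z)·(√((Mz+64)/8)^{2k+1})⁻¹` (`M > 0`,
`P ∈ halfIntModularForms (2k+1) N_P ψ`, `4 ∣ N_P`, `N_P ∣ 256M`): `B(z + 256) = B(z)`. [cite: Shimura1973HalfIntegral, §1] -/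
theorem bracket_periodic {k NP : ℕ} {ψ : DirichletCharacter ℂ NP} (h4 : 4 ∣ NP) {P : ℍ → ℂ}
    (hP : P ∈ halfIntModularForms (2 * k + 1) NP ψ) (γ₀ : SL(2, ℤ)) {M : ℕ} (hM : (γ₀ 1 0 : ℤ) = M) (h64 : (γ₀ 1 1 : ℤ) = 64)
    (hMpos : 0 < M) (hNP : (NP : ℤ) ∣ 256 * (M : ℤ)) (z : ℍ) :
    ((8 : ℂ)⁻¹) ^ (k + 1) * (P (γ₀ • ((256 : ℝ) +ᵥ z)) *
        (Complex.sqrt (((M : ℂ) * ((((256 : ℝ) +ᵥ z : ℍ)) : ℂ) + 64) / 8) ^ (2 * k + 1))⁻¹) =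
      ((8 : ℂ)⁻¹) ^ (k + 1) * (P (γ₀ • z) * (Complex.sqrt (((M : ℂ) * z + 64) / 8) ^ (2 * k + 1))⁻¹) := by
  congr 1
  have hX : 0 < (((M : ℂ) * z + 64) / 8).im := by
    rw [show ((M : ℂ) * z + 64) / 8 = ((M : ℂ) * z + 64) / ((8 : ℝ) : ℂ) by norm_num, Complex.div_ofReal_im]
    exact div_pos (im_level_mul_add_sixtyfour_pos hMpos z) (by norm_num)
  have h256 : ((((256 : ℝ) +ᵥ z : ℍ)) : ℂ) = (z : ℂ) + 256 := by rw [coe_vadd]; push_cast; ring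
  have hY : 0 < (((M : ℂ) * ((z : ℂ) + 256) + 64) / 8).im := by
    rw [show ((M : ℂ) * ((z : ℂ) + 256) + 64) / 8 = ((M : ℂ) * ((z : ℂ) + 256) + 64) / ((8 : ℝ) : ℂ) by norm_num,
      Complex.div_ofReal_im]
    have : ((M : ℂ) * ((z : ℂ) + 256) + 64).im = (M : ℝ) * z.im := by simp
    rw [this]; exact div_pos (mul_pos (by exact_mod_cast hMpos) z.im_pos) (by norm_num)
  rw [h256]
  refine cuspTranslate_periodic_of_ratio h4 hP γ₀ (M := (M : ℤ)) hM h64 (by exact_mod_cast hMpos.ne') hNP z hX hY ?_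
  have hX0 : ((M : ℂ) * z + 64) ≠ 0 := by
    intro h0; have := im_level_mul_add_sixtyfour_pos hMpos z; rw [h0] at this; simp at this
  push_cast
  field_simp

/-- The bracket composed with `ofComplex` is `N`-periodic for `256 ∣ N`. [folklore] -/
theorem bracket_periodic_comp_ofComplex {k NP : ℕ} {ψ : DirichletCharacter ℂ NP} (h4 : 4 ∣ NP) {P : ℍ → ℂ}
    (hP : P ∈ halfIntModularForms (2 * k + 1) NP ψ) (γ₀ : SL(2, ℤ)) {M : ℕ} (hM : (γ₀ 1 0 : ℤ) = M) (h64 : (γ₀ 1 1 : ℤ) = 64)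
    (hMpos : 0 < M) (hNP : (NP : ℤ) ∣ 256 * (M : ℤ)) {N : ℕ} (hN : 256 ∣ N) :
    Periodic ((fun z : ℍ ↦ ((8 : ℂ)⁻¹) ^ (k + 1) * (P (γ₀ • z) *
      (Complex.sqrt (((M : ℂ) * z + 64) / 8) ^ (2 * k + 1))⁻¹)) ∘ ofComplex) (N : ℝ) := by
  have h1 : Periodic ((fun z : ℍ ↦ ((8 : ℂ)⁻¹) ^ (k + 1) * (P (γ₀ • z) *
      (Complex.sqrt (((M : ℂ) * z + 64) / 8) ^ (2 * k + 1))⁻¹)) ∘ ofComplex) (256 : ℝ) := by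
    intro w
    by_cases hw : 0 < w.im
    · have h1w : 0 < (w + (256 : ℝ)).im := by simpa using hw
      simp only [Function.comp_apply]
      rw [ofComplex_apply_of_im_pos h1w, ofComplex_apply_of_im_pos hw]
      have e : (⟨w + (256 : ℝ), h1w⟩ : ℍ) = (256 : ℝ) +ᵥ ⟨w, hw⟩ := by
        ext; simp [coe_vadd, add_comm]
      rw [e]
      exact bracket_periodic h4 hP γ₀ hM h64 hMpos hNP ⟨w, hw⟩
    · simp only [Function.comp_apply]
      rw [ofComplex_apply_eq_of_im_nonpos (by simpa using not_lt.mp hw) (not_lt.mp hw)]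
  obtain ⟨n, rfl⟩ := hN
  have h := h1.nat_mul n
  have e : ((((256 * n : ℕ)) : ℝ) : ℂ) = (n : ℂ) * ((256 : ℝ) : ℂ) := by push_cast; ring
  rw [e]
  exact h

/-! ## §2 `B` is holomorphic and bounded at `i∞` -/

/-- **`B` is holomorphic** (`P` holomorphic, the Möbius action, and `√((Mz+64)/8) = j(·;M,64)/√8`, `M` odd). [folklore] -/
theorem mdifferentiable_bracket {k NP : ℕ} {ψ : DirichletCharacter ℂ NP} {P : ℍ → ℂ}
    (hP : P ∈ halfIntModularForms (2 * k + 1) NP ψ) (γ₀ : SL(2, ℤ)) {M : ℕ} (hModd : Odd M) :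
    MDifferentiable 𝓘(ℂ) 𝓘(ℂ) (fun z : ℍ ↦ ((8 : ℂ)⁻¹) ^ (k + 1) * (P (γ₀ • z) *
      (Complex.sqrt (((M : ℂ) * z + 64) / 8) ^ (2 * k + 1))⁻¹)) := by
  have h1 := mdifferentiable_comp_smul hP.1 γ₀
  have hgcd : Int.gcd M 64 = 1 := by
    obtain ⟨m, hm⟩ := hModd
    have hc : IsCoprime (M : ℤ) (2 ^ 6) := IsCoprime.pow_right ⟨1, -(m : ℤ), by rw [hm]; push_cast; ring⟩
    have := Int.isCoprime_iff_gcd_eq_one.mp hc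
    norm_num at this
    exact this
  have h2 : MDifferentiable 𝓘(ℂ) 𝓘(ℂ) (fun z : ℍ ↦ (Complex.sqrt (((M : ℂ) * z + 64) / 8) ^ (2 * k + 1))⁻¹) := by
    have e : (fun z : ℍ ↦ (Complex.sqrt (((M : ℂ) * z + 64) / 8) ^ (2 * k + 1))⁻¹) =
        fun z : ℍ ↦ ((thetaFactor M 64 z) ^ (2 * k + 1))⁻¹ * ((Real.sqrt 8 : ℝ) : ℂ) ^ (2 * k + 1) := by
      funext z
      rw [csqrt_level_div_eight_eq_thetaFactor hModd, mul_pow, mul_inv, inv_pow _ (2 * k + 1), inv_inv]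
    rw [e]
    refine MDifferentiable.mul ?_ mdifferentiable_const
    have hθ := (mdifferentiable_thetaFactor (M : ℤ) 64).pow (2 * k + 1)
    rw [UpperHalfPlane.mdifferentiable_iff] at hθ ⊢
    refine (hθ.inv fun w hw ↦ ?_).congr fun w hw ↦ by simp [Function.comp_apply]
    simp only [Function.comp_apply]
    exact pow_ne_zero _ (thetaFactor_ne_zero hgcd _)
  exact mdifferentiable_const.mul (h1.mul h2)

/-- **`B` is bounded at `i∞`:** `‖B(z)‖² = 8⁻¹·‖slashSq (2k+1) P γ₀ z‖`, and `P ∈ M_{(2k+1)/2}` satisfies the cusp condition at `γ₀`.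
[folklore] -/
theorem isBoundedAtImInfty_bracket {k NP : ℕ} {ψ : DirichletCharacter ℂ NP} {P : ℍ → ℂ}
    (hP : P ∈ halfIntModularForms (2 * k + 1) NP ψ) (γ₀ : SL(2, ℤ)) {M : ℕ} (hM : (γ₀ 1 0 : ℤ) = M) (h64 : (γ₀ 1 1 : ℤ) = 64) :
    IsBoundedAtImInfty (fun z : ℍ ↦ ((8 : ℂ)⁻¹) ^ (k + 1) * (P (γ₀ • z) *
      (Complex.sqrt (((M : ℂ) * z + 64) / 8) ^ (2 * k + 1))⁻¹)) := by
  have h := hP.2.2 γ₀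
  rw [isBoundedAtImInfty_iff] at h ⊢
  obtain ⟨B, A, hB⟩ := h
  refine ⟨Real.sqrt (8⁻¹ * B), A, fun z hz ↦ ?_⟩
  have hden : denom γ₀ z = (M : ℂ) * z + 64 := by rw [ModularGroup.denom_apply, hM, h64]; push_cast; ring
  have hX0 : (M : ℂ) * z + 64 ≠ 0 := by rw [← hden]; exact denom_ne_zero γ₀ z
  have hslash : ‖slashSq (2 * k + 1) P γ₀ z‖ = ‖P (γ₀ • z)‖ ^ 2 / ‖(M : ℂ) * z + 64‖ ^ (2 * k + 1) := by
    rw [norm_slashSq, hden]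
  have hsqC : (((8 : ℂ)⁻¹) ^ (k + 1) * (P (γ₀ • z) * (Complex.sqrt (((M : ℂ) * z + 64) / 8) ^ (2 * k + 1))⁻¹)) ^ 2 =
      (8 : ℂ)⁻¹ * slashSq (2 * k + 1) P γ₀ z := by
    have hs2 : (Complex.sqrt (((M : ℂ) * z + 64) / 8) ^ (2 * k + 1)) ^ 2 =
        ((M : ℂ) * z + 64) ^ (2 * k + 1) / 8 ^ (2 * k + 1) := by
      rw [← pow_mul, pow_mul', csqrt_sq, div_pow]
    simp only [slashSq, mul_pow, inv_pow]
    rw [hden, hs2]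
    have h8 : (8 : ℂ) ^ (2 * k + 1) ≠ 0 := pow_ne_zero _ (by norm_num)
    have hXk : ((M : ℂ) * z + 64) ^ (2 * k + 1) ≠ 0 := pow_ne_zero _ hX0
    field_simp
    ring
  have hsq : ‖((8 : ℂ)⁻¹) ^ (k + 1) * (P (γ₀ • z) * (Complex.sqrt (((M : ℂ) * z + 64) / 8) ^ (2 * k + 1))⁻¹)‖ ^ 2 =
      8⁻¹ * ‖slashSq (2 * k + 1) P γ₀ z‖ := by
    rw [← norm_pow, hsqC, norm_mul, norm_inv]
    norm_num
  have hle : ‖((8 : ℂ)⁻¹) ^ (k + 1) * (P (γ₀ • z) * (Complex.sqrt (((M : ℂ) * z + 64) / 8) ^ (2 * k + 1))⁻¹)‖ ^ 2 ≤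
      8⁻¹ * B := by
    rw [hsq]; exact mul_le_mul_of_nonneg_left (hB z hz) (by norm_num)
  calc ‖((8 : ℂ)⁻¹) ^ (k + 1) * (P (γ₀ • z) * (Complex.sqrt (((M : ℂ) * z + 64) / 8) ^ (2 * k + 1))⁻¹)‖
      = Real.sqrt (‖((8 : ℂ)⁻¹) ^ (k + 1) * (P (γ₀ • z) *
          (Complex.sqrt (((M : ℂ) * z + 64) / 8) ^ (2 * k + 1))⁻¹)‖ ^ 2) := (Real.sqrt_sq (norm_nonneg _)).symm
    _ ≤ Real.sqrt (8⁻¹ * B) := Real.sqrt_le_sqrt hle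

/-- `B` has an analytic cusp function at period `N` (`256 ∣ N`, `N ≥ 1`) and Mathlib's `HasSum` of its `qExpansion N`. [cite: DiamondShurman2005, §1.1] -/
theorem bracket_analytic_and_hasSum {k NP : ℕ} {ψ : DirichletCharacter ℂ NP} (h4 : 4 ∣ NP) {P : ℍ → ℂ}
    (hP : P ∈ halfIntModularForms (2 * k + 1) NP ψ) (γ₀ : SL(2, ℤ)) {M : ℕ} (hM : (γ₀ 1 0 : ℤ) = M) (h64 : (γ₀ 1 1 : ℤ) = 64)
    (hModd : Odd M) (hNP : (NP : ℤ) ∣ 256 * (M : ℤ)) {N : ℕ} (hN : 256 ∣ N) (hN0 : 0 < N) :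
    AnalyticAt ℂ (cuspFunction N (fun z : ℍ ↦ ((8 : ℂ)⁻¹) ^ (k + 1) * (P (γ₀ • z) *
      (Complex.sqrt (((M : ℂ) * z + 64) / 8) ^ (2 * k + 1))⁻¹))) 0 ∧
    ∀ τ : ℍ, HasSum (fun m : ℕ ↦ (qExpansion N (fun z : ℍ ↦ ((8 : ℂ)⁻¹) ^ (k + 1) * (P (γ₀ • z) *
      (Complex.sqrt (((M : ℂ) * z + 64) / 8) ^ (2 * k + 1))⁻¹))).coeff m • Periodic.qParam N (τ : ℂ) ^ m)
      (((8 : ℂ)⁻¹) ^ (k + 1) * (P (γ₀ • τ) * (Complex.sqrt (((M : ℂ) * τ + 64) / 8) ^ (2 * k + 1))⁻¹)) := by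
  have hper := bracket_periodic_comp_ofComplex h4 hP γ₀ hM h64 hModd.pos hNP hN
  have hhol := mdifferentiable_bracket hP γ₀ hModd (k := k)
  have hbdd := isBoundedAtImInfty_bracket hP γ₀ hM h64 (k := k)
  have hNR : (0 : ℝ) < N := by exact_mod_cast hN0
  exact ⟨UpperHalfPlane.analyticAt_cuspFunction_zero hNR hper hhol hbdd,
    fun τ ↦ UpperHalfPlane.hasSum_qExpansion hNR hper hhol hbdd τ⟩

/-! ## §3 The transport -/

/-- **P4d — THE NF-Q TRANSPORT AT THE 2-ADIC FLIPPED CUSP.** NF-Q (Katz 1973 Cor. 1.6.2, hypothesis); `γ₀ = [a b; M 64] ∈ SL₂(ℤ)`, `M` odd;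
`f : ModularForm (Gamma1 L) (k+1)` whose function is the Katz vehicle `P·θ` (`P ∈ halfIntModularForms (2k+1) N_P ψ`, `4 ∣ N_P ∣ 256M` — P2's
`classProj c g` at level `128M` qualifies), `L ∣ N`, `3 ≤ N`, `256 ∣ N`, `M ∣ N`, and EVERY coefficient of `qExpansion 1 f` in `p·ℤ̄[1/N]`
(the class hypothesis at `∞`). Then EVERY coefficient of `qExpansion N B`, `B(z) = 8^{−(k+1)}·P(γ₀•z)·(√((Mz+64)/8)^{2k+1})⁻¹` — P1's
bracket — lies in `p·ℤ̄[1/N]`: P4b's factorisation `f ∣ γ₀ = Θ·B`, P4c's Θ-hypotheses, §2's `B`-analyticity, and w3 g19's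
`exists_isIntegral_qExpansion_coeff_of_slash_eq_mul`. CONDITIONAL on NF-Q (hypothesis). [cite: Katz1973, §1.6 Cor. 1.6.2]
[cite: Shimura1973HalfIntegral, §1] -/
theorem exists_isIntegral_bracket_coeff
    (hKatz : Literature.NumberTheory.ModularForms.Katz1973_qExpansionPrinciple_allCusps)
    {k M : ℕ} [NeZero M] (hModd : Odd M) (γ₀ : SL(2, ℤ)) (hM : (γ₀ 1 0 : ℤ) = M) (h64 : (γ₀ 1 1 : ℤ) = 64)
    {L N : ℕ} (hLN : L ∣ N) (hN3 : 3 ≤ N) (h256 : 256 ∣ N) (hMN : M ∣ N)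
    (f : ModularForm (Gamma1 L) ((k + 1 : ℕ) : ℤ)) {P : ℍ → ℂ} (hf : ∀ z : ℍ, f z = P z * shimuraTheta z)
    {NP : ℕ} {ψ : DirichletCharacter ℂ NP} (h4 : 4 ∣ NP) (hP : P ∈ halfIntModularForms (2 * k + 1) NP ψ)
    (hNP : (NP : ℤ) ∣ 256 * (M : ℤ)) (p : ℕ)
    (hcoef : ∀ n : ℕ, ∃ y : ℂ, (∃ j : ℕ, IsIntegral ℤ ((N : ℂ) ^ j * y)) ∧ (qExpansion 1 ⇑f).coeff n = (p : ℂ) * y)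
    (n : ℕ) :
    ∃ y : ℂ, (∃ j : ℕ, IsIntegral ℤ ((N : ℂ) ^ j * y)) ∧
      (qExpansion N (fun z : ℍ ↦ ((8 : ℂ)⁻¹) ^ (k + 1) * (P (γ₀ • z) *
        (Complex.sqrt (((M : ℂ) * z + 64) / 8) ^ (2 * k + 1))⁻¹))).coeff n = (p : ℂ) * y := by
  have hN0 : 0 < N := by omega
  have h16 : 16 ∣ N := (show (16 : ℕ) ∣ 256 by norm_num).trans h256
  obtain ⟨hΘ, hΘint, hΘ0⟩ := theta_transport_hypotheses γ₀ hM h64 hModd h16 hN0 hMN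
  obtain ⟨hB, -⟩ := bracket_analytic_and_hasSum h4 hP γ₀ hM h64 hModd hNP h256 hN0 (k := k)
  exact exists_isIntegral_qExpansion_coeff_of_slash_eq_mul hKatz hLN hN3 f p hcoef γ₀
    (fun z ↦ slash_flippedCusp_eq_theta_mul_bracket γ₀ hM h64 k hf z) hΘ hB hΘint hΘ0 n

end Summit.BirchSwinnertonDyer.BirchSwinnertonDyer.Theorems.PrintCFram.FlipRung

end
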